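import Literature.Geometry.Lorentzian.CoordBoundaryCoercivityIntegrals
import HarnessLib

/-!
# The coercivity estimate (3.4) of Chruściel–Delay near the boundary, in coordinates

Topic `Literature/Geometry/Lorentzian`, coordinate tensor calculus `MetricCoord` (Riemannian metric
components `G` on an open set `V` of dimension `≠ 1`, vacuum-type data `(G, K)` with `K` a smooth
field of symmetric forms, a boundary defining function `x` smooth on `V`). Everything here is
PROVED; no definition and no statement of `Prop` type is introduced.

**Inequality (3.4) of Chruściel–Delay** (Mém. SMF 94 (2003), Prop. 3.3, the hypothesis of the
isomorphism Thm. 3.6 behind Thm. 5.9) asks that for all `(Y, N)` supported near the boundary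
`C ‖Φ P*(Y, N)‖_{L²_ψ} ≥ ‖Y‖_{L²_ψ} + ‖N‖_{H̊¹_{φ,ψ}}` with `φ = x²`, `ψ = e^{s/x}`. The proof of
Thm. 5.9 (p. 29) obtains it from (5.12) (Cor. D.5 + Cauchy–Schwarz) for `Y` and from Prop. C.4
applied with `u = x²∇N` and `u = N` for `N`. This file assembles exactly that, for the tree's KID
operator rows `R_K = adjHamK N + adjMomKS Y` (principal part `−S(Y)`, weight `x²`) and
`R_G = adjHamG N + adjMomGS Y` (principal part `Hess N`, weight `x⁴`):

* **`IsMetricOn.boundaryCoercivity`** — if on a collar `{0 < x < x₁}` the defining function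
  satisfies `m ≤ |∇x|² ≤ M₁`, `|Δx| ≤ M₂`, `|Hess x(v,v)| ≤ M₃|v|²`, and the geometry/data are
  bounded there (`Ric(v,v) ≤ ρ|v|²`, `|tr K G + 2K|² ≤ w₁`, `|Z|² ≤ z₁`, `|K|² ≤ k₁`, `|∇K|² ≤ k₂`;
  on a compact collar these are consequences of smoothness up to the boundary, and they make the
  terms of Chruściel–Delay's condition (5.10) small as `x → 0`), then for every `σ > 0` there are
  `x₀ > 0` and `C` such that for all `N, Y` smooth on `V` with compact support in `{0 < x < x₀}`
  `∫ √g e^{2σ/x}(|Y|² + N² + x⁴|∇N|²) ≤ C ∫ √g e^{2σ/x}(x⁴|R_K|² + x⁸|R_G|²)`.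

* **`IsMetricOn.boundaryCoercivity_full`** — the same estimate with the full weighted
  `H̊¹ × H̊²` norm on the left, `∫ √g e^{2σ/x}(|Y|² + x⁴ Q(∇Y) + N² + x⁴|∇N|² + x⁸|Hess N|²)`
  (`Q(∇Y) = tr_G G(∇Y·,∇Y·)`), which is what the printed proof actually bounds and is the norm of
  (3.5); `boundaryCoercivity` is its corollary.

The eight constituent inequalities are `CoordWeightedKornBoundary` (5.12),
`CoordBoundaryCoercivityIntegrals` (II)–(VIII); the absorption for `x₀` small is `absorb_aux`.

## References

* P. T. Chruściel, E. Delay, Mém. Soc. Math. Fr. 94 (2003), §3 Prop. 3.3 (3.4), Thm. 5.9 (proof,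
  p. 29), (5.10), (5.12), App. C Prop. C.4, App. D Cor. D.5. [ChruscielDelay2003]
-/

noncomputable section

set_option maxSynthPendingDepth 3

open Set Filter Module Function MeasureTheory
open scoped Topology ContDiff

namespace Literature.Geometry.Lorentzian

namespace MetricCoord

/-! ### The absorption -/

/-- **The absorption step**: from `Nn ≤ P·H`, `τ ≤ c RK + 3θ₁ Nn`, `Mm ≤ μ₁ τ`,
`H ≤ a RG + 3θ₂ Nn + a Mm` and the smallness `3θ₂P ≤ ¼`, `3aμ₁θ₁P ≤ ¼` one gets
`H ≤ 2a RG + 2aμ₁c RK`. Pure real arithmetic. [cite: ChruscielDelay2003, Thm. 5.9 (proof)] -/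
theorem absorb_aux {Nn H RK RG τ Mm P cn θ₁ θ₂ an μ₁ : ℝ}
    (hH : 0 ≤ H) (hRK : 0 ≤ RK) (hRG : 0 ≤ RG)
    (hθ₁ : 0 ≤ θ₁) (hθ₂ : 0 ≤ θ₂) (han : 0 ≤ an) (hμ₁ : 0 ≤ μ₁) (hcn : 0 ≤ cn)
    (i1 : Nn ≤ P * H) (i2 : τ ≤ cn * RK + 3 * θ₁ * Nn) (i3 : Mm ≤ μ₁ * τ)
    (i4 : H ≤ an * RG + 3 * θ₂ * Nn + an * Mm)
    (small1 : 3 * θ₂ * P ≤ 4⁻¹) (small2 : 3 * an * μ₁ * θ₁ * P ≤ 4⁻¹) :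
    H ≤ 2 * an * RG + 2 * an * μ₁ * cn * RK := by
  have hτ2 : τ ≤ cn * RK + 3 * θ₁ * (P * H) := by
    have := mul_le_mul_of_nonneg_left i1 (by positivity : 0 ≤ 3 * θ₁)
    linarith
  have hMm2 : Mm ≤ μ₁ * (cn * RK + 3 * θ₁ * (P * H)) := i3.trans (mul_le_mul_of_nonneg_left hτ2 hμ₁)
  have hH2 : H ≤ an * RG + 3 * θ₂ * (P * H) + an * (μ₁ * (cn * RK + 3 * θ₁ * (P * H))) := by
    have a := mul_le_mul_of_nonneg_left i1 (by positivity : 0 ≤ 3 * θ₂)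
    have b' := mul_le_mul_of_nonneg_left hMm2 han
    linarith [i4]
  have expand : an * RG + 3 * θ₂ * (P * H) + an * (μ₁ * (cn * RK + 3 * θ₁ * (P * H))) =
      an * RG + an * μ₁ * cn * RK + (3 * θ₂ * P + 3 * an * μ₁ * θ₁ * P) * H := by ring
  rw [expand] at hH2
  have hcoef : (3 * θ₂ * P + 3 * an * μ₁ * θ₁ * P) * H ≤ 2⁻¹ * H :=
    mul_le_mul_of_nonneg_right (by linarith) hH
  have hpos1 : 0 ≤ an * RG := by positivity
  have hpos2 : 0 ≤ an * μ₁ * cn * RK := by positivity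
  linarith

/-! ### The estimate -/

variable {E : Type*} [NormedAddCommGroup E] [NormedSpace ℝ E] [FiniteDimensional ℝ E]
  [CompleteSpace E] {ι : Type*} [Fintype ι] [DecidableEq ι] (b : Basis ι ℝ E)
  {G : E → E →L[ℝ] E →L[ℝ] ℝ} {V : Set E} {K : E → E →L[ℝ] E →L[ℝ] ℝ} {xf : E → ℝ}
  [MeasurableSpace E] [BorelSpace E] (μ : Measure E) [μ.IsAddHaarMeasure]

set_option maxHeartbeats 1600000 in
/-- **The coercivity estimate of Chruściel–Delay 2003 near the boundary, full weighted
`H̊¹ × H̊²` form** (the norm of (3.5)), in coordinates. Under the hypotheses of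
`IsMetricOn.boundaryCoercivity` below: for every `σ > 0` there are `x₀ > 0` and `C` such that for
all `N, Y` smooth on `V` with compact support in `{0 < x < x₀}`,
`∫ √g e^{2σ/x}(|Y|² + x⁴ Q(∇Y)) + ∫ √g e^{2σ/x}(N² + x⁴|∇N|² + x⁸|Hess N|²)
   ≤ C (∫ √g e^{2σ/x}x⁴|R_K|² + ∫ √g e^{2σ/x}x⁸|R_G|²)`,
`Q(∇Y) = tr_G G(∇Y·, ∇Y·)`, i.e. `‖Y‖_{H̊¹_{φ,ψ}} + ‖N‖_{H̊²_{φ,ψ}} ≤ C‖Φ P*(Y,N)‖_{L²_ψ}` with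
`ψ = e^{σ/x}`, `φ = x²`, `Φ = diag(x², x⁴)` for `(Y, N)` supported near the boundary. The printed
proof of Thm. 5.9 (p. 29) bounds exactly these five quantities ((5.12) for `Y`, Prop. C.4 with
`u = x²∇N` and `u = N`, the `Hess N`-row and the weighted Korn inequality for `∇Y`); (3.4) as
printed keeps only `‖Y‖_{L²_ψ} + ‖N‖_{H̊¹_{φ,ψ}}` on the left, see `IsMetricOn.boundaryCoercivity`.
[cite: ChruscielDelay2003, Prop. 3.3 (3.4)–(3.5), Thm. 5.9 (proof)] -/
theorem IsMetricOn.boundaryCoercivity_full (hG : IsMetricOn G V)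
    (hpos : ∀ y ∈ V, ∀ e : E, e ≠ 0 → 0 < G y e e) (hn : finrank ℝ E ≠ 1)
    (hK : ContDiffOn ℝ ∞ K V) (hKs : ∀ y ∈ V, ∀ v w, K y v w = K y w v)
    (hxf : ContDiffOn ℝ ∞ xf V) {x₁ m M₁ M₂ M₃ ρ w₁ z₁ k₁ k₂ : ℝ}
    (hx₁ : 0 < x₁) (hm : 0 < m) (hmM : m ≤ M₁) (hM₂ : 0 ≤ M₂) (hM₃ : 0 ≤ M₃) (hρ : 0 ≤ ρ)
    (hw₁ : 0 ≤ w₁) (hz₁ : 0 ≤ z₁) (hk₁ : 0 ≤ k₁) (hk₂ : 0 ≤ k₂)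
    (hgrad : ∀ y ∈ V, 0 < xf y → xf y < x₁ → m ≤ gradSqAt G xf y ∧ gradSqAt G xf y ≤ M₁)
    (hlap : ∀ y ∈ V, 0 < xf y → xf y < x₁ → |lapAt G xf y| ≤ M₂)
    (hhess : ∀ y ∈ V, 0 < xf y → xf y < x₁ → ∀ v : E, |hessAt G xf y v v| ≤ M₃ * G y v v)
    (hric : ∀ y ∈ V, 0 < xf y → xf y < x₁ → ∀ v : E, ricAt G y v v ≤ ρ * G y v v)
    (hWK : ∀ y ∈ V, 0 < xf y → xf y < x₁ →
      normSqAt G y (mtrAt G y (K y) • G y + (2 : ℝ) • K y) ≤ w₁)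
    (hZ : ∀ y ∈ V, 0 < xf y → xf y < x₁ →
      normSqAt G y (ricAt G y - (2 : ℝ) • (K y).comp ((sharpAt G y).comp (K y))
        + (2 * mtrAt G y (K y)) • K y
        + (((finrank ℝ E : ℝ) - 1)⁻¹ * (-scalAt G y
            + 2 * mtrAt G y ((K y).comp ((sharpAt G y).comp (K y)))
            - 2 * mtrAt G y (K y) ^ 2)) • G y) ≤ z₁)
    (hKn : ∀ y ∈ V, 0 < xf y → xf y < x₁ → normSqAt G y (K y) ≤ k₁)
    (hcovK : ∀ y ∈ V, 0 < xf y → xf y < x₁ →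
      ∑ k, ∑ l, ginv G b y k l * pairAt G y (cov₂At G K y (b k)) (cov₂At G K y (b l)) ≤ k₂)
    {σ : ℝ} (hσ : 0 < σ) :
    ∃ x₀ : ℝ, 0 < x₀ ∧ ∃ C : ℝ, ∀ (N : E → ℝ) (Y : E → E), ContDiffOn ℝ ∞ N V →
      ContDiffOn ℝ ∞ Y V → HasCompactSupport N → HasCompactSupport Y →
      tsupport N ⊆ {y ∈ V | 0 < xf y ∧ xf y < x₀} → tsupport Y ⊆ {y ∈ V | 0 < xf y ∧ xf y < x₀} →
      ∫ y, sqrtDetGram G b y * (Real.exp (2 * σ / xf y) * G y (Y y) (Y y)) ∂μ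
        + ∫ y, sqrtDetGram G b y * (Real.exp (2 * σ / xf y) * xf y ^ 4
            * mtrAt G y ((G y).bilinearComp (covDAt G Y y) (covDAt G Y y))) ∂μ
        + ∫ y, sqrtDetGram G b y * (Real.exp (2 * σ / xf y) * N y ^ 2) ∂μ
        + ∫ y, sqrtDetGram G b y * (Real.exp (2 * σ / xf y) * xf y ^ 4 * gradSqAt G N y) ∂μ
        + ∫ y, sqrtDetGram G b y * (Real.exp (2 * σ / xf y) * xf y ^ 8
            * normSqAt G y (hessAt G N y)) ∂μ ≤
      C * (∫ y, sqrtDetGram G b y * (Real.exp (2 * σ / xf y) * xf y ^ 4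
              * normSqAt G y (adjHamK G K N y + adjMomKS G Y y)) ∂μ
          + ∫ y, sqrtDetGram G b y * (Real.exp (2 * σ / xf y) * xf y ^ 8
              * normSqAt G y (adjHamG G K N y + adjMomGS G K Y y)) ∂μ) := by
  -- the three bricks with their own collars
  obtain ⟨xB, hxB, hB5⟩ :=
    hG.integral_weightedKorn_boundary b μ hpos hxf hx₁ hm hmM hM₂ hM₃ hgrad hlap hhess hσ
  obtain ⟨xN, hxN, hIII⟩ := hG.integral_N_sq_le b μ hpos hxf hx₁ hm hM₂
    (fun y hy hx hxx ↦ (hgrad y hy hx hxx).1) hlap hσ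
  obtain ⟨xD, hxD, hIV⟩ := hG.integral_gradN_le b μ hpos hxf hx₁ hm hM₂
    (fun y hy hx hxx ↦ (hgrad y hy hx hxx).1) hlap hσ
  -- the constants
  set n : ℝ := (finrank ℝ E : ℝ) with hndef
  set CY : ℝ := 16 * M₁ / (σ * m) ^ 2 with hCY
  set cn : ℝ := 3 + 3 * (3 / (2 * (n - 1))) ^ 2 * n ^ 2 with hcn
  set an : ℝ := 6 * (1 + ((n - 1)⁻¹) ^ 2 * n ^ 2) with han
  set sn : ℝ := 2 + n ^ 2 / 2 with hsn
  set CK : ℝ := 2 * (3 * (σ + 2) ^ 2 * M₁ + ρ) with hCK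
  set c1 : ℝ := 4 + 3 * n with hc1
  set c2 : ℝ := 1 + 2 * n ^ 2 with hc2
  set CN1 : ℝ := (σ ^ 2 / 2 * m)⁻¹ with hCN1
  set CN2 : ℝ := 4 * (σ ^ 2 / 2 * m)⁻¹ with hCN2
  set P : ℝ := CN1 * CN2 with hP
  set mu : ℝ := c1 * k₁ * (4 * sn + CK * CY) + c2 * k₂ * CY with hmu
  have hn0 : 0 ≤ n := Nat.cast_nonneg _
  have hM₁ : 0 < M₁ := hm.trans_le hmM
  have hCY0 : 0 ≤ CY := by positivity
  have hcn0 : 0 ≤ cn := by positivity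
  have han0 : 0 ≤ an := by positivity
  have hsn0 : 0 ≤ sn := by positivity
  have hCK0 : 0 ≤ CK := by positivity
  have hc10 : 0 ≤ c1 := by positivity
  have hc20 : 0 ≤ c2 := by positivity
  have hsm : 0 < σ ^ 2 / 2 * m := by positivity
  have hCN10 : 0 ≤ CN1 := by positivity
  have hCN20 : 0 ≤ CN2 := by positivity
  have hP0 : 0 ≤ P := by positivity
  have hmu0 : 0 ≤ mu := by positivity
  set xS1 : ℝ := (12 * z₁ * P + 1)⁻¹ with hxS1
  set xS2 : ℝ := (12 * an * mu * w₁ * P + 1)⁻¹ with hxS2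
  have hxS10 : 0 < xS1 := by positivity
  have hxS20 : 0 < xS2 := by positivity
  set x₀ : ℝ := min (min (min xB xN) (min xD (min x₁ 1))) (min xS1 xS2) with hx₀
  have hx₀pos : 0 < x₀ := by positivity
  have hx₀B : x₀ ≤ xB := ((min_le_left _ _).trans (min_le_left _ _)).trans (min_le_left _ _)
  have hx₀N : x₀ ≤ xN := ((min_le_left _ _).trans (min_le_left _ _)).trans (min_le_right _ _)
  have hx₀D : x₀ ≤ xD := ((min_le_left _ _).trans (min_le_right _ _)).trans (min_le_left _ _)
  have hx₀x₁ : x₀ ≤ x₁ :=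
    (((min_le_left _ _).trans (min_le_right _ _)).trans (min_le_right _ _)).trans (min_le_left _ _)
  have hx₀1 : x₀ ≤ 1 :=
    (((min_le_left _ _).trans (min_le_right _ _)).trans (min_le_right _ _)).trans (min_le_right _ _)
  have hx₀S1 : x₀ ≤ xS1 := (min_le_right _ _).trans (min_le_left _ _)
  have hx₀S2 : x₀ ≤ xS2 := (min_le_right _ _).trans (min_le_right _ _)
  set Hc : ℝ := 2 * an * (1 + x₀ * mu * cn) with hHc
  have hHc0 : 0 ≤ Hc := by positivity
  refine ⟨x₀, hx₀pos, CY * (cn + 3 * (x₀ * w₁) * P * Hc) + (P + CN2) * Hc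
      + (4 * sn + CK * CY) * (cn + 3 * (x₀ * w₁) * P * Hc) + Hc,
    fun N Y hN hY hNs hYs hNS hYS ↦ ?_⟩
  -- the quantities
  set Yy := ∫ y, sqrtDetGram G b y * (Real.exp (2 * σ / xf y) * G y (Y y) (Y y)) ∂μ with hYy
  set Nn := ∫ y, sqrtDetGram G b y * (Real.exp (2 * σ / xf y) * N y ^ 2) ∂μ with hNn
  set D := ∫ y, sqrtDetGram G b y * (Real.exp (2 * σ / xf y) * xf y ^ 4 * gradSqAt G N y) ∂μ with hD
  set H := ∫ y, sqrtDetGram G b y * (Real.exp (2 * σ / xf y) * xf y ^ 8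
    * normSqAt G y (hessAt G N y)) ∂μ with hH
  set RK := ∫ y, sqrtDetGram G b y * (Real.exp (2 * σ / xf y) * xf y ^ 4
    * normSqAt G y (adjHamK G K N y + adjMomKS G Y y)) ∂μ with hRK
  set RG := ∫ y, sqrtDetGram G b y * (Real.exp (2 * σ / xf y) * xf y ^ 8
    * normSqAt G y (adjHamG G K N y + adjMomGS G K Y y)) ∂μ with hRG
  set τ := ∫ y, sqrtDetGram G b y * (Real.exp (2 * σ / xf y) * xf y ^ 4
    * normSqAt G y (symAt ((G y).comp (covDAt G Y y)) + (2⁻¹ * divAt G Y y) • G y)) ∂μ with hτ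
  set Qq := ∫ y, sqrtDetGram G b y * (Real.exp (2 * σ / xf y) * xf y ^ 4
    * mtrAt G y ((G y).bilinearComp (covDAt G Y y) (covDAt G Y y))) ∂μ with hQq
  set Mm := ∫ y, sqrtDetGram G b y * (Real.exp (2 * σ / xf y) * xf y ^ 8
    * normSqAt G y (adjMomGS G K Y y)) ∂μ with hMm
  set Ss := ∫ y, sqrtDetGram G b y * (Real.exp (2 * σ / xf y) * xf y ^ 4
    * normSqAt G y (symAt ((G y).comp (covDAt G Y y)))) ∂μ with hSs
  -- the eight inequalities
  have hYB : tsupport Y ⊆ {y ∈ V | 0 < xf y ∧ xf y < xB} := fun y hy ↦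
    ⟨(hYS hy).1, (hYS hy).2.1, (hYS hy).2.2.trans_le hx₀B⟩
  have i1 : Yy ≤ CY * τ := hB5 Y hY hYs hYB
  have i2 : τ ≤ cn * RK + 3 * (x₀ * w₁) * Nn :=
    hG.integral_kidT_le b μ hpos hn hK hxf σ hx₀1 hx₀x₁ hWK hN hY hNs hYs hNS hYS
  have i3 : (σ ^ 2 / 2 * m) * Nn ≤ D := hIII x₀ hx₀N hx₀x₁ N hN hNs hNS
  have i4 : (σ ^ 2 / 2 * m) * D ≤ 4 * H := hIV x₀ hx₀D hx₀x₁ N hN hNs hNS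
  have i5 : H ≤ an * RG + 3 * (x₀ * z₁) * Nn + an * Mm :=
    hG.integral_hessAt_le b μ hpos hn hK hxf σ hx₀1 hx₀x₁ hZ hN hY hNs hYs hNS hYS
  have i6 : Mm ≤ c1 * (x₀ * k₁) * Qq + c2 * (x₀ * k₂) * Yy :=
    hG.integral_adjMomGS_le b μ hpos hK hKs hxf σ hx₀1 hx₀x₁ hKn hcovK hY hYs hYS
  have i7 : Qq ≤ 4 * Ss + CK * Yy :=
    hG.integral_gradY_le b μ hpos hxf hx₀1 hx₀x₁ hσ.le hρ hric
      (fun y hy hx hxx ↦ (hgrad y hy hx hxx).2) hY hYs hYS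
  have i8 : Ss ≤ sn * τ := hG.integral_symAt_le b μ hpos hxf σ hx₀x₁ hY hYs hYS
  -- nonnegativity of the quantities (integrands vanish off the support, are `≥ 0` on it)
  have hSx₀ : tsupport N ∪ tsupport Y ⊆ {y ∈ V | 0 < xf y ∧ xf y < x₀} := union_subset hNS hYS
  have nonneg : ∀ {k : E → ℝ}, (∀ y ∈ tsupport N ∪ tsupport Y, 0 ≤ k y) →
      (∀ y ∉ tsupport N ∪ tsupport Y, k y = 0) → 0 ≤ ∫ y, sqrtDetGram G b y * k y ∂μ := by
    intro k hk hk0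
    refine integral_nonneg fun y ↦ ?_
    show 0 ≤ sqrtDetGram G b y * k y
    by_cases hy : y ∈ tsupport N ∪ tsupport Y
    · exact mul_nonneg (Real.sqrt_nonneg _) (hk y hy)
    · rw [hk0 y hy, mul_zero]
  have van : ∀ y ∉ tsupport N ∪ tsupport Y,
      normSqAt G y (adjHamK G K N y + adjMomKS G Y y) = 0 ∧
      normSqAt G y (adjHamG G K N y + adjMomGS G K Y y) = 0 ∧
      normSqAt G y (hessAt G N y) = 0 ∧
      normSqAt G y (symAt ((G y).comp (covDAt G Y y)) + (2⁻¹ * divAt G Y y) • G y) = 0 := by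
    intro y hy
    obtain ⟨hNz, hYz⟩ := eventuallyEq_zero_of_notMem_union hy
    obtain ⟨hRK0, hRG0, hcov, hdiv, hhess0, -⟩ :=
      kidRows_eq_zero_of_eventuallyEq (G := G) (K := K) hNz hYz
    have hs0 : symAt (0 : E →L[ℝ] E →L[ℝ] ℝ) = 0 := by ext v w; simp [symAt_apply]
    refine ⟨by simp [hRK0, normSqAt_eq_traceCLM], by simp [hRG0, normSqAt_eq_traceCLM],
      by simp [hhess0, normSqAt_eq_traceCLM], ?_⟩
    rw [hcov, hdiv, ContinuousLinearMap.comp_zero, hs0, mul_zero, zero_smul, add_zero]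
    simp [normSqAt_eq_traceCLM]
  have hRK0 : 0 ≤ RK := nonneg
    (fun y hy ↦ mul_nonneg (by positivity)
      (normSqAt_nonneg_of_pos hG (hSx₀ hy).1 (hpos y (hSx₀ hy).1) _))
    (fun y hy ↦ by rw [(van y hy).1, mul_zero])
  have hRG0 : 0 ≤ RG := nonneg
    (fun y hy ↦ mul_nonneg (by positivity)
      (normSqAt_nonneg_of_pos hG (hSx₀ hy).1 (hpos y (hSx₀ hy).1) _))
    (fun y hy ↦ by rw [(van y hy).2.1, mul_zero])
  have hH0 : 0 ≤ H := nonneg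
    (fun y hy ↦ mul_nonneg (by positivity)
      (normSqAt_nonneg_of_pos hG (hSx₀ hy).1 (hpos y (hSx₀ hy).1) _))
    (fun y hy ↦ by rw [(van y hy).2.2.1, mul_zero])
  have hτ0 : 0 ≤ τ := nonneg
    (fun y hy ↦ mul_nonneg (by positivity)
      (normSqAt_nonneg_of_pos hG (hSx₀ hy).1 (hpos y (hSx₀ hy).1) _))
    (fun y hy ↦ by rw [(van y hy).2.2.2, mul_zero])
  -- chaining
  have j1 : Nn ≤ CN1 * D := by
    rw [hCN1, show (σ ^ 2 / 2 * m)⁻¹ * D = D / (σ ^ 2 / 2 * m) by ring, le_div_iff₀ hsm]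
    linarith only [i3]
  have j2 : D ≤ CN2 * H := by
    rw [hCN2, show 4 * (σ ^ 2 / 2 * m)⁻¹ * H = (4 * H) / (σ ^ 2 / 2 * m) by ring, le_div_iff₀ hsm]
    linarith only [i4]
  have jNn : Nn ≤ P * H := by
    calc Nn ≤ CN1 * D := j1
      _ ≤ CN1 * (CN2 * H) := mul_le_mul_of_nonneg_left j2 hCN10
      _ = P * H := by rw [hP]; ring
  have jMm : Mm ≤ (x₀ * mu) * τ := by
    have a1 : Qq ≤ (4 * sn + CK * CY) * τ := by
      have b1 := mul_le_mul_of_nonneg_left i1 hCK0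
      have b2 := mul_le_mul_of_nonneg_left i8 (by norm_num : (0 : ℝ) ≤ 4)
      have e : (4 * sn + CK * CY) * τ = 4 * (sn * τ) + CK * (CY * τ) := by ring
      rw [e]
      linarith only [i7, b1, b2]
    have a2 := mul_le_mul_of_nonneg_left a1 (by positivity : 0 ≤ c1 * (x₀ * k₁))
    have a3 := mul_le_mul_of_nonneg_left i1 (by positivity : 0 ≤ c2 * (x₀ * k₂))
    calc Mm ≤ c1 * (x₀ * k₁) * Qq + c2 * (x₀ * k₂) * Yy := i6
      _ ≤ c1 * (x₀ * k₁) * ((4 * sn + CK * CY) * τ) + c2 * (x₀ * k₂) * (CY * τ) := add_le_add a2 a3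
      _ = (x₀ * mu) * τ := by rw [hmu]; ring
  -- smallness
  have small1 : 3 * (x₀ * z₁) * P ≤ 4⁻¹ := by
    have h1 : x₀ * (12 * z₁ * P + 1) ≤ 1 := by
      rw [← le_div_iff₀ (by positivity : (0 : ℝ) < 12 * z₁ * P + 1), one_div]
      exact hx₀S1
    have e : x₀ * (12 * z₁ * P + 1) = 4 * (3 * (x₀ * z₁) * P) + x₀ := by ring
    rw [e] at h1
    linarith only [h1, hx₀pos.le]
  have small2 : 3 * an * (x₀ * mu) * (x₀ * w₁) * P ≤ 4⁻¹ := by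
    have h1 : x₀ * (12 * an * mu * w₁ * P + 1) ≤ 1 := by
      rw [← le_div_iff₀ (by positivity : (0 : ℝ) < 12 * an * mu * w₁ * P + 1), one_div]
      exact hx₀S2
    have h2 : x₀ * x₀ ≤ x₀ := by nlinarith only [hx₀pos, hx₀1]
    have h3 : 0 ≤ an * mu * w₁ * P := by positivity
    have h4 := mul_le_mul_of_nonneg_right h2 h3
    have e1 : 3 * an * (x₀ * mu) * (x₀ * w₁) * P = 3 * (x₀ * x₀ * (an * mu * w₁ * P)) := by ring
    have e2 : x₀ * (12 * an * mu * w₁ * P + 1) = 12 * (x₀ * (an * mu * w₁ * P)) + x₀ := by ring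
    rw [e1]
    rw [e2] at h1
    linarith only [h1, h4, hx₀pos.le]
  -- absorb
  have jH : H ≤ 2 * an * RG + 2 * an * (x₀ * mu) * cn * RK :=
    absorb_aux hH0 hRK0 hRG0 (by positivity) (by positivity) han0 (by positivity) hcn0
      jNn i2 jMm i5 small1 small2
  have jH' : H ≤ Hc * (RK + RG) := by
    have p1 : 0 ≤ 2 * an * (x₀ * mu) * cn * RG := by positivity
    have p2 : 0 ≤ 2 * an * RK := by positivity
    have e : Hc * (RK + RG) = 2 * an * RG + 2 * an * (x₀ * mu) * cn * RK
        + (2 * an * (x₀ * mu) * cn * RG + 2 * an * RK) := by rw [hHc]; ring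
    rw [e]
    linarith only [jH, p1, p2]
  have jD : D ≤ CN2 * (Hc * (RK + RG)) := j2.trans (mul_le_mul_of_nonneg_left jH' hCN20)
  have jN : Nn ≤ P * (Hc * (RK + RG)) := jNn.trans (mul_le_mul_of_nonneg_left jH' hP0)
  have jτ : τ ≤ (cn + 3 * (x₀ * w₁) * P * Hc) * (RK + RG) := by
    have a := mul_le_mul_of_nonneg_left jN (by positivity : 0 ≤ 3 * (x₀ * w₁))
    have p1 : 0 ≤ cn * RG := mul_nonneg hcn0 hRG0
    have e : (cn + 3 * (x₀ * w₁) * P * Hc) * (RK + RG) =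
        cn * RK + cn * RG + 3 * (x₀ * w₁) * (P * (Hc * (RK + RG))) := by ring
    rw [e]
    linarith only [i2, a, p1]
  have jY : Yy ≤ CY * ((cn + 3 * (x₀ * w₁) * P * Hc) * (RK + RG)) :=
    i1.trans (mul_le_mul_of_nonneg_left jτ hCY0)
  have jQ : Qq ≤ (4 * sn + CK * CY) * ((cn + 3 * (x₀ * w₁) * P * Hc) * (RK + RG)) := by
    have a1 : Qq ≤ (4 * sn + CK * CY) * τ := by
      have b1 := mul_le_mul_of_nonneg_left i1 hCK0
      have b2 := mul_le_mul_of_nonneg_left i8 (by norm_num : (0 : ℝ) ≤ 4)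
      have e : (4 * sn + CK * CY) * τ = 4 * (sn * τ) + CK * (CY * τ) := by ring
      rw [e]
      linarith only [i7, b1, b2]
    exact a1.trans (mul_le_mul_of_nonneg_left jτ (by positivity))
  have e : (CY * (cn + 3 * (x₀ * w₁) * P * Hc) + (P + CN2) * Hc
        + (4 * sn + CK * CY) * (cn + 3 * (x₀ * w₁) * P * Hc) + Hc) * (RK + RG) =
      CY * ((cn + 3 * (x₀ * w₁) * P * Hc) * (RK + RG)) + P * (Hc * (RK + RG))
        + CN2 * (Hc * (RK + RG))
        + (4 * sn + CK * CY) * ((cn + 3 * (x₀ * w₁) * P * Hc) * (RK + RG))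
        + Hc * (RK + RG) := by ring
  rw [e]
  linarith only [jY, jN, jD, jQ, jH']

/-- **The coercivity estimate (3.4) of Chruściel–Delay 2003 near the boundary**, in coordinates.
Let `G` be Riemannian metric components on `V` (`dim ≠ 1`), `K` a smooth field of symmetric forms
on `V`, `x` smooth on `V`, and suppose that on the collar `{0 < x < x₁}`:
`m ≤ |∇x|² ≤ M₁`, `|Δx| ≤ M₂`, `|Hess x(v,v)| ≤ M₃|v|²`, `Ric(v,v) ≤ ρ|v|²`,
`|(tr K)G + 2K|² ≤ w₁`, `|Z|² ≤ z₁` (`Z = Ric − 2K∘K + 2(tr K)K + (n−1)⁻¹(−scal + 2tr(K∘K) − 2(tr K)²)G`),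
`|K|² ≤ k₁`, `|∇K|² ≤ k₂`. Then for every `σ > 0` there are `x₀ > 0` and `C` such that for all
`N, Y` smooth on `V` with compact support in `{0 < x < x₀}`,
`∫ √g e^{2σ/x}|Y|² + ∫ √g e^{2σ/x}N² + ∫ √g e^{2σ/x}x⁴|∇N|²
   ≤ C (∫ √g e^{2σ/x}x⁴|R_K|² + ∫ √g e^{2σ/x}x⁸|R_G|²)`,
`R_K = adjHamK N + adjMomKS Y`, `R_G = adjHamG N + adjMomGS Y`: in the exponentially weighted norms
(`ψ = e^{σ/x}`, `φ = x²`, `Φ = diag(x², x⁴)`), `‖Y‖_{L²_ψ} + ‖N‖_{H̊¹_{φ,ψ}} ≤ C‖Φ P*(Y,N)‖_{L²_ψ}`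
for `(Y, N)` supported near the boundary — inequality (3.4).
Proof as printed (p. 29): (5.12) for `Y`; Prop. C.4 with `u = x²∇N` and `u = N` for `N`; the
coupling and lower-order terms of `P*` are absorbed for `x₀` small ((5.10)).
[cite: ChruscielDelay2003, Prop. 3.3 (3.4), Thm. 5.9 (proof)] -/
theorem IsMetricOn.boundaryCoercivity (hG : IsMetricOn G V)
    (hpos : ∀ y ∈ V, ∀ e : E, e ≠ 0 → 0 < G y e e) (hn : finrank ℝ E ≠ 1)
    (hK : ContDiffOn ℝ ∞ K V) (hKs : ∀ y ∈ V, ∀ v w, K y v w = K y w v)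
    (hxf : ContDiffOn ℝ ∞ xf V) {x₁ m M₁ M₂ M₃ ρ w₁ z₁ k₁ k₂ : ℝ}
    (hx₁ : 0 < x₁) (hm : 0 < m) (hmM : m ≤ M₁) (hM₂ : 0 ≤ M₂) (hM₃ : 0 ≤ M₃) (hρ : 0 ≤ ρ)
    (hw₁ : 0 ≤ w₁) (hz₁ : 0 ≤ z₁) (hk₁ : 0 ≤ k₁) (hk₂ : 0 ≤ k₂)
    (hgrad : ∀ y ∈ V, 0 < xf y → xf y < x₁ → m ≤ gradSqAt G xf y ∧ gradSqAt G xf y ≤ M₁)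
    (hlap : ∀ y ∈ V, 0 < xf y → xf y < x₁ → |lapAt G xf y| ≤ M₂)
    (hhess : ∀ y ∈ V, 0 < xf y → xf y < x₁ → ∀ v : E, |hessAt G xf y v v| ≤ M₃ * G y v v)
    (hric : ∀ y ∈ V, 0 < xf y → xf y < x₁ → ∀ v : E, ricAt G y v v ≤ ρ * G y v v)
    (hWK : ∀ y ∈ V, 0 < xf y → xf y < x₁ →
      normSqAt G y (mtrAt G y (K y) • G y + (2 : ℝ) • K y) ≤ w₁)
    (hZ : ∀ y ∈ V, 0 < xf y → xf y < x₁ →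
      normSqAt G y (ricAt G y - (2 : ℝ) • (K y).comp ((sharpAt G y).comp (K y))
        + (2 * mtrAt G y (K y)) • K y
        + (((finrank ℝ E : ℝ) - 1)⁻¹ * (-scalAt G y
            + 2 * mtrAt G y ((K y).comp ((sharpAt G y).comp (K y)))
            - 2 * mtrAt G y (K y) ^ 2)) • G y) ≤ z₁)
    (hKn : ∀ y ∈ V, 0 < xf y → xf y < x₁ → normSqAt G y (K y) ≤ k₁)
    (hcovK : ∀ y ∈ V, 0 < xf y → xf y < x₁ →
      ∑ k, ∑ l, ginv G b y k l * pairAt G y (cov₂At G K y (b k)) (cov₂At G K y (b l)) ≤ k₂)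
    {σ : ℝ} (hσ : 0 < σ) :
    ∃ x₀ : ℝ, 0 < x₀ ∧ ∃ C : ℝ, ∀ (N : E → ℝ) (Y : E → E), ContDiffOn ℝ ∞ N V →
      ContDiffOn ℝ ∞ Y V → HasCompactSupport N → HasCompactSupport Y →
      tsupport N ⊆ {y ∈ V | 0 < xf y ∧ xf y < x₀} → tsupport Y ⊆ {y ∈ V | 0 < xf y ∧ xf y < x₀} →
      ∫ y, sqrtDetGram G b y * (Real.exp (2 * σ / xf y) * G y (Y y) (Y y)) ∂μ
        + ∫ y, sqrtDetGram G b y * (Real.exp (2 * σ / xf y) * N y ^ 2) ∂μ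
        + ∫ y, sqrtDetGram G b y * (Real.exp (2 * σ / xf y) * xf y ^ 4 * gradSqAt G N y) ∂μ ≤
      C * (∫ y, sqrtDetGram G b y * (Real.exp (2 * σ / xf y) * xf y ^ 4
              * normSqAt G y (adjHamK G K N y + adjMomKS G Y y)) ∂μ
          + ∫ y, sqrtDetGram G b y * (Real.exp (2 * σ / xf y) * xf y ^ 8
              * normSqAt G y (adjHamG G K N y + adjMomGS G K Y y)) ∂μ) := by
  obtain ⟨x₀, hx₀, C, h⟩ := hG.boundaryCoercivity_full b μ hpos hn hK hKs hxf hx₁ hm hmM hM₂ hM₃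
    hρ hw₁ hz₁ hk₁ hk₂ hgrad hlap hhess hric hWK hZ hKn hcovK hσ
  refine ⟨x₀, hx₀, C, fun N Y hN hY hNs hYs hNS hYS ↦ ?_⟩
  have hfull := h N Y hN hY hNs hYs hNS hYS
  -- the two dropped terms are nonnegative: on the support the integrands are `≥ 0`
  -- (Riemannian metric), off it they vanish
  have van : ∀ y ∉ tsupport N ∪ tsupport Y,
      covDAt G Y y = 0 ∧ hessAt G N y = 0 := by
    intro y hy
    obtain ⟨hNz, hYz⟩ := eventuallyEq_zero_of_notMem_union hy
    obtain ⟨-, -, hcov, -, hhess0, -⟩ :=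
      kidRows_eq_zero_of_eventuallyEq (G := G) (K := K) hNz hYz
    exact ⟨hcov, hhess0⟩
  have hSV : tsupport N ∪ tsupport Y ⊆ V := union_subset (fun y hy ↦ (hNS hy).1)
    (fun y hy ↦ (hYS hy).1)
  have hQ : 0 ≤ ∫ y, sqrtDetGram G b y * (Real.exp (2 * σ / xf y) * xf y ^ 4
      * mtrAt G y ((G y).bilinearComp (covDAt G Y y) (covDAt G Y y))) ∂μ := by
    refine integral_nonneg fun y ↦ ?_
    show 0 ≤ sqrtDetGram G b y * _
    by_cases hy : y ∈ tsupport N ∪ tsupport Y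
    · have hyV := hSV hy
      have hx4 : 0 ≤ xf y ^ 4 := by positivity
      exact mul_nonneg (Real.sqrt_nonneg _) (mul_nonneg (mul_nonneg (Real.exp_nonneg _) hx4)
        (hG.mtrAt_bilinearComp_nonneg hyV (hpos y hyV) _))
    · rw [(van y hy).1, mtrAt_eq_sum b]
      simp
  have hH : 0 ≤ ∫ y, sqrtDetGram G b y * (Real.exp (2 * σ / xf y) * xf y ^ 8
      * normSqAt G y (hessAt G N y)) ∂μ := by
    refine integral_nonneg fun y ↦ ?_
    show 0 ≤ sqrtDetGram G b y * _
    by_cases hy : y ∈ tsupport N ∪ tsupport Y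
    · have hyV := hSV hy
      have hx8 : 0 ≤ xf y ^ 8 := by positivity
      exact mul_nonneg (Real.sqrt_nonneg _) (mul_nonneg (mul_nonneg (Real.exp_nonneg _) hx8)
        (normSqAt_nonneg_of_pos hG hyV (hpos y hyV) _))
    · rw [(van y hy).2]
      simp [normSqAt_eq_traceCLM]
  linarith only [hfull, hQ, hH]

end MetricCoord

end Literature.Geometry.Lorentzian

end
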